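import Mathlib
import Literature.NumberTheory.LFunctions.Zhang2022.Section4Statements
import Literature.NumberTheory.LFunctions.Zhang2022.Section4Lemma42Holds
import Literature.NumberTheory.LFunctions.Zhang2022.Section4PartialIntegration
import HarnessLib

/-!
# Zhang (2022), §4 Lemma 4.2: the typed proof steps `Z22:§4.u007`, `Z22:§4.u008`, `Z22:Lem4.2.pf`
# DISCHARGED (over the §4a statement file of record `Section4Statements`)

Topic `Literature/NumberTheory/LFunctions/Zhang2022` (Landau–Siegel audit tree; verdict-neutral).
Y. Zhang, *Discrete mean estimates and the Landau–Siegel zero*, arXiv:2211.02515v1 (2022)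
[Zhang2022LandauSiegel] — **an unrefereed manuscript under adjudication.** The typed CLAIM nodes of
the proof of Lemma 4.2 [Z22 p.17, tex L931–L944] in `Section4Statements` (L1-t3) are theorems:

* `Section4.fgSubOneEq_holds : FGSubOneEq` — `Z22:§4.u007` "`F(s,ψ)G(s,ψ) − 1 =
  Σ_{D⁴<n≤D⁸} ς(n)ψ(n)n^{−s}`" (= `Skeleton.Fpoly_mul_Gpoly_sub_one`);
* `Section4.fgSubOneBound_holds : FGSubOneBound` — `Z22:§4.u008` "`FG − 1 ≪ 𝓛⁴⁰⁶(|X₄(D⁸,ψ)| +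
  ∫_{D⁴}^{D⁸}|X₄(x,ψ)|x⁻¹dx)`" with implied constant `1`, threshold `D ≥ ⌈e³²⌉`
  (`norm_Fpoly_mul_Gpoly_sub_one_le` below, the display for EVERY `ψ ∈ Ψ`);
* `Section4.ded42_holds : Ded42` — `Z22:Lem4.2.pf` "the right side being `O(𝓛⁻²²⁷)` by (3.6)":
  `FGSubOneBound → Skeleton.Lemma42`, the implication proved from its antecedent and the definition
  of `Ψ₁` (constant `C₄₂ = max(C,0)` from the antecedent's `C`).

Nothing about Theorems 1–2 of the source or about Landau–Siegel zeros is stated or implied.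

## References

* Y. Zhang, arXiv:2211.02515v1 (2022), §4 p. 17, Lemma 4.2 (proof). [cite: Zhang2022LandauSiegel, §4 Lemma 4.2]
-/

noncomputable section

open Complex Real Finset

namespace Literature.NumberTheory.LFunctions.Zhang2022.Section4

open Skeleton

/-! ## The display of the proof of Lemma 4.2, for every `ψ ∈ Ψ` -/

/-- **"`F(s,ψ)G(s,ψ) − 1 ≪ 𝓛⁴⁰⁶(|X₄(D⁸,ψ)| + ∫_{D⁴}^{D⁸} |X₄(x,ψ)|x⁻¹dx)`"** (second display of the
proof of Lemma 4.2, DAG `Z22:§4.u008`), EXPLICIT and for EVERY `ψ ∈ Ψ` (not only `Ψ₁`): for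
`D ≥ ⌈e³²⌉` and `s ∈ Ω₁`, `|FG − 1| ≤ 𝓛⁴⁰⁶·(|X₄(D⁸,ψ)| + ∫_{D⁴}^{D⁸}|X₄(x,ψ)|dx/x)` with implied
constant `1` (from `Fpoly_mul_Gpoly_sub_one` and the tree's `Lemma41.norm_sum_Ioc_le`, using
`𝓛^{4/5} ≤ 𝓛⁴⁰⁶`). [cite: Zhang2022LandauSiegel, §4 Lemma 4.2 (proof)] -/
theorem norm_Fpoly_mul_Gpoly_sub_one_le {D : ℕ} [NeZero D] (χ : DirichletCharacter ℂ D)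
    (hD : ⌈Real.exp 32⌉₊ ≤ D) (x : Chr D) {s : ℂ} (hs : s ∈ Omega1 D) :
    ‖Fpoly χ x s * Gpoly χ x s - 1‖ ≤ ell D ^ 406 *
      (‖X4 χ x ((D : ℝ) ^ 8)‖ + ∫ y in (D : ℝ) ^ 4..(D : ℝ) ^ 8, ‖X4 χ x y‖ / y) := by
  have hL : 32 ≤ ell D := by
    have h : Real.exp 32 ≤ D := le_trans (Nat.le_ceil _) (by exact_mod_cast hD)
    exact (Real.le_log_iff_exp_le (lt_of_lt_of_le (Real.exp_pos _) h)).mpr h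
  have hL1 : 1 ≤ ell D := by linarith
  have hL0 : 0 < ell D := by linarith
  have hD1 : 1 ≤ D := NeZero.one_le
  have hD1' : (1 : ℝ) ≤ D := by exact_mod_cast hD1
  set c : ℕ → ℂ := fun n => sig χ n * x.ψ (n : ZMod x.p) * (n : ℂ) ^ (-s0 D) with hc
  set z : ℂ := s0 D - s with hz
  have hfloor4 : ⌊(D : ℝ) ^ 4⌋₊ = D ^ 4 := by rw [← Nat.cast_pow, Nat.floor_natCast]
  have hfloor8 : ⌊(D : ℝ) ^ 8⌋₊ = D ^ 8 := by rw [← Nat.cast_pow, Nat.floor_natCast]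
  have hX4 : Lemma41.Xsum c ((D : ℝ) ^ 4) = X4 χ x := by
    funext y
    rw [Lemma41.Xsum_eq_sum_Ioc, hfloor4, X4]
  have hsum : Fpoly χ x s * Gpoly χ x s - 1
      = ∑ n ∈ Ioc ⌊(D : ℝ) ^ 4⌋₊ ⌊(D : ℝ) ^ 8⌋₊, c n * (n : ℂ) ^ z := by
    rw [Fpoly_mul_Gpoly_sub_one, hfloor4, hfloor8]
    refine Finset.sum_congr rfl fun n hn => ?_
    have hn0 : (n : ℂ) ≠ 0 := by
      have : 0 < n := lt_of_le_of_lt (Nat.zero_le _) (Finset.mem_Ioc.mp hn).1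
      exact_mod_cast this.ne'
    rw [hc, hz, mul_assoc (sig χ n * x.ψ (n : ZMod x.p)), ← Complex.cpow_add _ _ hn0]
    congr 2
    ring
  rw [Omega1, Lemma43.mem_Omega1_iff] at hs
  obtain ⟨hs1, hs2, hs3⟩ := hs
  have hlogle : Real.log (ell D) / (100 * ell D) ≤ 1 / 100 := by
    rw [div_le_div_iff₀ (by positivity) (by norm_num)]
    have := Real.log_le_sub_one_of_pos hL0
    linarith
  have hzre : z.re = 1 / 2 - s.re := by rw [hz, Complex.sub_re, s0_re]
  have hzim : z.im = 2 * π * t0 D - s.im := by rw [hz, Complex.sub_im, s0_im]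
  have hz1 : z.re ≤ Real.log (ell D) / (100 * ell D) := by rw [hzre]; linarith
  have hz2 : |z.re| ≤ 1 := by rw [hzre, abs_le]; constructor <;> linarith
  have hz3 : |z.im| ≤ ell D ^ (405 : ℝ) + 5 := by
    rw [hzim, abs_sub_comm, Real.rpow_ofNat]
    rw [ell1] at hs3
    exact hs3.le
  have hab : (D : ℝ) ^ 4 ≤ (D : ℝ) ^ 8 := pow_le_pow_right₀ hD1' (by norm_num)
  have ha1 : (1 : ℝ) ≤ (D : ℝ) ^ 4 := one_le_pow₀ hD1'
  have hbX : (D : ℝ) ^ 8 ≤ Real.exp (80 * ell D) := by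
    rw [ell, ← Real.log_le_iff_le_exp (by positivity), Real.log_pow]
    have := Real.log_nonneg hD1'
    push_cast
    linarith
  have key := Lemma41.norm_sum_Ioc_le c hL ha1 hab hbX hz1 hz2 hz3
  rw [← hsum, hX4] at key
  have hI0 : 0 ≤ ∫ y in (D : ℝ) ^ 4..(D : ℝ) ^ 8, ‖X4 χ x y‖ / y :=
    intervalIntegral.integral_nonneg hab fun y hy =>
      div_nonneg (norm_nonneg _) (by linarith [hy.1])
  have h45 : ell D ^ (4 / 5 : ℝ) ≤ ell D ^ (406 : ℝ) :=
    Real.rpow_le_rpow_of_exponent_le hL1 (by norm_num)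
  have h406 : ell D ^ (406 : ℝ) = ell D ^ 406 := Real.rpow_ofNat _ _
  calc ‖Fpoly χ x s * Gpoly χ x s - 1‖
      ≤ ell D ^ (4 / 5 : ℝ) * ‖X4 χ x ((D : ℝ) ^ 8)‖
          + ell D ^ (406 : ℝ) * ∫ y in (D : ℝ) ^ 4..(D : ℝ) ^ 8, ‖X4 χ x y‖ / y := key
    _ ≤ ell D ^ (406 : ℝ) * ‖X4 χ x ((D : ℝ) ^ 8)‖
          + ell D ^ (406 : ℝ) * ∫ y in (D : ℝ) ^ 4..(D : ℝ) ^ 8, ‖X4 χ x y‖ / y := by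
        gcongr
    _ = ell D ^ 406 *
          (‖X4 χ x ((D : ℝ) ^ 8)‖ + ∫ y in (D : ℝ) ^ 4..(D : ℝ) ^ 8, ‖X4 χ x y‖ / y) := by
        rw [h406]; ring


/-- **`Z22:§4.u007` HOLDS**: "`F(s,ψ)G(s,ψ) − 1 = Σ_{D⁴<n≤D⁸} ς(n)ψ(n)n^{−s}`" [Z22 p.17, tex L933].
[cite: Zhang2022LandauSiegel, §4 Lemma 4.2 (proof)] -/
theorem fgSubOneEq_holds : FGSubOneEq := fun _ _ χ x s => Fpoly_mul_Gpoly_sub_one χ x s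

/-- **`Z22:§4.u008` HOLDS** (implied constant `1`, `D ≥ ⌈e³²⌉`): "`F(s,ψ)G(s,ψ) − 1 ≪
𝓛⁴⁰⁶(|X₄(D⁸,ψ)| + ∫_{D⁴}^{D⁸}|X₄(x,ψ)|x⁻¹dx)`" for `s ∈ Ω₁`, every `ψ ∈ Ψ` [Z22 p.17, tex L937–L941].
[cite: Zhang2022LandauSiegel, §4 Lemma 4.2 (proof)] -/
theorem fgSubOneBound_holds : FGSubOneBound := by
  refine ⟨1, ⌈Real.exp 32⌉₊, fun D _ χ hD _ _ x s hs => ?_⟩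
  rw [one_mul]
  exact norm_Fpoly_mul_Gpoly_sub_one_le χ hD x hs

/-- `⌈e³⌉ ≤ D` gives `1 < 𝓛`. [cite: Zhang2022LandauSiegel, §2 (2.1)] -/
private theorem one_lt_ell_of_le {D : ℕ} (hD : ⌈Real.exp 3⌉₊ ≤ D) : 1 < ell D := by
  have h : Real.exp 3 ≤ D := le_trans (Nat.le_ceil _) (by exact_mod_cast hD)
  have h3 : (3 : ℝ) ≤ ell D := (Real.le_log_iff_exp_le (lt_of_lt_of_le (Real.exp_pos _) h)).mpr h
  linarith

/-- **`Z22:Lem4.2.pf` HOLDS as an implication**: "the right side being `O(𝓛⁻²²⁷)` by (3.6)" —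
from the bound `|FG − 1| ≤ C𝓛⁴⁰⁶(|X₄(D⁸)| + ∫|X₄|dx/x)` (the antecedent `FGSubOneBound`) and
`ψ ∈ Ψ₁` (so (3.6): the bracket is `< 𝓛⁻⁶³³`) to `|FG − 1| ≤ max(C,0)·𝓛⁻²²⁷` (`406 − 633 = −227`).
[cite: Zhang2022LandauSiegel, §4 Lemma 4.2 (proof)] -/
theorem ded42_holds : Ded42 := by
  rintro ⟨C, D₀, hC⟩
  refine ⟨max C 0, max D₀ ⌈Real.exp 3⌉₊, fun D _ χ hD hq hp x hx s hs => ?_⟩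
  have hb := hC D χ (le_trans (le_max_left _ _) hD) hq hp x s hs
  have h36 : ‖X4 χ x ((D : ℝ) ^ 8)‖ + ∫ y in (D : ℝ) ^ 4..(D : ℝ) ^ 8, ‖X4 χ x y‖ / y
      < (ell D ^ 633)⁻¹ := hx.2.2
  have hL : 1 < ell D := one_lt_ell_of_le (le_trans (le_max_right _ _) hD)
  have hL0 : 0 < ell D := by linarith
  have hB0 : 0 ≤ ‖X4 χ x ((D : ℝ) ^ 8)‖ + ∫ y in (D : ℝ) ^ 4..(D : ℝ) ^ 8, ‖X4 χ x y‖ / y := by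
    have hD1 : (1 : ℝ) ≤ D := by
      have : Real.exp 3 ≤ D := le_trans (Nat.le_ceil _)
        (by exact_mod_cast (le_trans (le_max_right _ _) hD))
      linarith [Real.add_one_le_exp (3 : ℝ)]
    have hab : (D : ℝ) ^ 4 ≤ (D : ℝ) ^ 8 := pow_le_pow_right₀ hD1 (by norm_num)
    exact add_nonneg (norm_nonneg _) (intervalIntegral.integral_nonneg hab fun y hy =>
      div_nonneg (norm_nonneg _) (by nlinarith [hy.1, one_le_pow₀ (n := 4) hD1]))
  have hpow : ell D ^ 406 * (ell D ^ 633)⁻¹ = (ell D ^ 227)⁻¹ := by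
    rw [show (633 : ℕ) = 227 + 406 by norm_num, pow_add, mul_inv, mul_comm, mul_assoc,
      inv_mul_cancel₀ (pow_ne_zero _ hL0.ne'), mul_one]
  calc ‖Fpoly χ x s * Gpoly χ x s - 1‖
      ≤ C * ell D ^ 406 *
          (‖X4 χ x ((D : ℝ) ^ 8)‖ + ∫ y in (D : ℝ) ^ 4..(D : ℝ) ^ 8, ‖X4 χ x y‖ / y) := hb
    _ ≤ max C 0 * ell D ^ 406 *
          (‖X4 χ x ((D : ℝ) ^ 8)‖ + ∫ y in (D : ℝ) ^ 4..(D : ℝ) ^ 8, ‖X4 χ x y‖ / y) := by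
        gcongr
        exact le_max_left _ _
    _ = max C 0 * (ell D ^ 406 *
          (‖X4 χ x ((D : ℝ) ^ 8)‖ + ∫ y in (D : ℝ) ^ 4..(D : ℝ) ^ 8, ‖X4 χ x y‖ / y)) := by ring
    _ ≤ max C 0 * (ell D ^ 406 * (ell D ^ 633)⁻¹) := by gcongr
    _ = max C 0 * (ell D ^ 227)⁻¹ := by rw [hpow]

end Literature.NumberTheory.LFunctions.Zhang2022.Section4

/-! ## `_holds` aliases (appended 2026-08-28)

The named fact(s) below are already theorems of the tree under a differently-cased `_holds` name; the exact-name `_holds`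
alias records the discharge under the tree's naming convention (D-0026 bookkeeping: proof term =
the existing theorem, no statement or definition edited). -/

/-- `FGSubOneEq` is a theorem of the tree (`Literature.NumberTheory.LFunctions.Zhang2022.Section4.fgSubOneEq_holds`). [cite: Zhang2022LandauSiegel, §4 Lemma 4.2 (proof) p. 17] -/
theorem _root_.Literature.NumberTheory.LFunctions.Zhang2022.Section4.FGSubOneEq_holds : _root_.Literature.NumberTheory.LFunctions.Zhang2022.Section4.FGSubOneEq :=
  _root_.Literature.NumberTheory.LFunctions.Zhang2022.Section4.fgSubOneEq_holds

/-- `FGSubOneBound` is a theorem of the tree (`Literature.NumberTheory.LFunctions.Zhang2022.Section4.fgSubOneBound_holds`). [cite: Zhang2022LandauSiegel, §4 Lemma 4.2 (proof) p. 17] -/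
theorem _root_.Literature.NumberTheory.LFunctions.Zhang2022.Section4.FGSubOneBound_holds : _root_.Literature.NumberTheory.LFunctions.Zhang2022.Section4.FGSubOneBound :=
  _root_.Literature.NumberTheory.LFunctions.Zhang2022.Section4.fgSubOneBound_holds
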